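import Mathlib
import Summits.Ventures.PercRepro2.Defs
import Summits.Ventures.PercRepro2.Independence
import Summits.Ventures.PercRepro2.Harris
import Summits.Ventures.PercRepro2.Graph
import Summits.Ventures.PercRepro2.Events
import Summits.Ventures.PercRepro2.Induced
import Summits.Ventures.PercRepro2.BHKAvoid
import Summits.Ventures.PercRepro2.ZCPendantSecondOrder
import Summits.Ventures.PercRepro2.CDZero

/-!
# The odds lemma of row 2′CD is stable under every cluster up-set (blind cell PercRepro2, mine-a g31;
MINE-A.md §86.7)

Two roots `a₁, a₂`, marks `a₃, o`; `Q = {a₁ ↮ a₂}`, `W = C₁ ∪ C₂`, `e = {a₃ ∈ C₁}`, `f = {o ∈ C₂}`,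
`N = {a₃ ∉ W}`, and `U = {C₁ ∈ 𝓔}` for an up-set `𝓔` of vertex sets.  The odds lemma (CD₀)
(`CDZero.cd_zero`: `P_Q(o ∈ C₂ ∣ a₃ ∈ C₁) ≤ P_Q(o ∈ W ∣ a₃ ∉ W)`) survives conditioning on ANY cluster
up-set of the root, with the smaller constant `P_Q(o ∈ C₂ ∣ a₃ ∉ W)`:

  `(OL-𝓔)   P(Q ∩ U ∩ e ∩ f) · P(Q ∩ N) ≤ P(Q ∩ U ∩ e) · P(Q ∩ N ∩ f)`,

i.e. `P_Q(o ∈ C₂ ∣ C₁ ∈ 𝓔, a₃ ∈ C₁) ≤ P_Q(o ∈ C₂ ∣ a₃ ∉ C₁ ∪ C₂)`.  Proof: in the world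
`R = {C₂ avoids {a₁, a₃}}` two instances of the van den Berg–Häggström–Kahn cross-cluster inequality
(`bhk_cross_cluster_avoid`, the cluster of `a₂` avoiding `{a₁, a₃}`, against `{o ∈ C₂}`): with the up-set
`𝓔 ∩ {a₃ ∈ ·}` of `C₁`, `P(R U e f)·P(R) ≤ P(R f)·P(R U e)`, and with `{a₃ ∈ ·}`,
`P(R e f)·P(R) ≤ P(R f)·P(R e)`, i.e. `P(R f)·P(R eᶜ) ≤ P(R eᶜ f)·P(R)`; chaining,
`P(RUef)·P(Reᶜ)·P(R) ≤ P(RUe)·P(Rf)·P(Reᶜ) ≤ P(RUe)·P(Reᶜf)·P(R)`.  The four events are the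
`Q`-events of the statement (`Q ∩ e = R ∩ e`, `Q ∩ N = R ∩ eᶜ`).  The consequence
`P_Q(o ∈ C₂ ∣ C₁ ∈ 𝓔, a₃ ∈ C₁) ≤ γ := P_Q(o ∈ W ∣ a₃ ∉ W)` is `odds_upset_gamma`.  In contrast, the
covariance form of the row (`Cov_Q(U, e(γ − f)) ≥ 0`) is NOT implied: it needs the `a₃`-required
cross covariance `Cov_{Q ∩ e}(U, f)`, which can be positive (MINE-A.md §86.1 (I2)).  No definition;
one seat.
-/

namespace Summit.Ventures.PercRepro2

namespace CDOddsUpset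

section Sets

variable {V : Type*} {E : Type*} (ends : E → Sym2 V) (a₁ a₃ : V)

/-- `{C(a₁) ∈ 𝓔 ∩ {W ∣ a₃ ∈ W}} = {C(a₁) ∈ 𝓔} ∩ {a₁ ↔ a₃}`. -/
lemma clusterInEvent_inter_mem_eq (𝓔 : Set (Set V)) :
    clusterInEvent ends a₁ (𝓔 ∩ {W : Set V | a₃ ∈ W}) =
      clusterInEvent ends a₁ 𝓔 ∩ connEvent ends a₁ a₃ := by
  ext ω
  simp only [mem_clusterInEvent, Set.mem_inter_iff, Set.mem_setOf_eq, mem_cluster, mem_connEvent]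

/-- The intersection of an up-set of vertex sets with `{W ∣ a₃ ∈ W}` is an up-set. -/
lemma isUpperSet_inter_mem {𝓔 : Set (Set V)} (h𝓔 : IsUpperSet 𝓔) :
    IsUpperSet (𝓔 ∩ {W : Set V | a₃ ∈ W}) :=
  h𝓔.inter (ZCPendant.isUpperSet_mem_o (V := V) a₃)

end Sets

section Main

variable {V : Type*} {E : Type*} [Fintype E] [DecidableEq E] [Fintype V] [DecidableEq V]
  {R : Type*} [Field R] [LinearOrder R] [IsStrictOrderedRing R]

/-- **(OL-𝓔)**: for every up-set `𝓔` of vertex sets, with `Q = {a₁ ↮ a₂}`, `U = {C₁ ∈ 𝓔}`,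
`e = {a₃ ∈ C₁}`, `f = {o ∈ C₂}`, `N = {a₃ ∉ C₁} ∩ {a₃ ∉ C₂}`:
`P(Q ∩ U ∩ e ∩ f) · P(Q ∩ N) ≤ P(Q ∩ U ∩ e) · P(Q ∩ N ∩ f)`, i.e.
`P_Q(o ∈ C₂ ∣ C₁ ∈ 𝓔, a₃ ∈ C₁) ≤ P_Q(o ∈ C₂ ∣ a₃ ∉ C₁ ∪ C₂)`. -/
theorem odds_upset (p : E → R) (hp : IsProbVec p) (ends : E → Sym2 V) (a₁ a₂ a₃ o : V)
    {𝓔 : Set (Set V)} (h𝓔 : IsUpperSet 𝓔) :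
    let Q := (connEvent ends a₁ a₂)ᶜ
    let U := clusterInEvent ends a₁ 𝓔
    let e := connEvent ends a₁ a₃
    let f := connEvent ends a₂ o
    let N := (connEvent ends a₁ a₃)ᶜ ∩ (connEvent ends a₂ a₃)ᶜ
    prob p (Q ∩ U ∩ e ∩ f) * prob p (Q ∩ N) ≤ prob p (Q ∩ U ∩ e) * prob p (Q ∩ N ∩ f) := by
  intro Q U e f N
  -- the avoidance world `R = {a₂ ↮ {a₁, a₃}}`
  set Rv := avoidAll ends a₂ {a₁, a₃} with hRv
  have hR : Rv = Q ∩ (connEvent ends a₂ a₃)ᶜ := CDZero.avoidAll_a₂_pair_eq ends a₁ a₂ a₃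
  -- BHK cross-cluster with the up-set `𝓔 ∩ {a₃ ∈ ·}` of `C₁`
  have hbhk1 := bhk_cross_cluster_avoid p hp ends a₂ a₁ (X := {a₁, a₃}) (by simp)
    (ZCPendant.isUpperSet_mem_o (V := V) o) (isUpperSet_inter_mem a₃ h𝓔)
  rw [ZCPendant.clusterInEvent_mem_o_eq, clusterInEvent_inter_mem_eq] at hbhk1
  -- `hbhk1 : P(f ∩ (U ∩ e) ∩ R) * P(R) ≤ P(f ∩ R) * P((U ∩ e) ∩ R)`
  -- BHK cross-cluster with the up-set `{a₃ ∈ ·}` of `C₁`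
  have hbhk2 := bhk_cross_cluster_avoid p hp ends a₂ a₁ (X := {a₁, a₃}) (by simp)
    (ZCPendant.isUpperSet_mem_o (V := V) o) (ZCPendant.isUpperSet_mem_o (V := V) a₃)
  rw [ZCPendant.clusterInEvent_mem_o_eq, ZCPendant.clusterInEvent_mem_o_eq] at hbhk2
  -- `hbhk2 : P(f ∩ e ∩ R) * P(R) ≤ P(f ∩ R) * P(e ∩ R)`
  -- the four events of the statement in the `R`-world
  have s1 : Q ∩ e = Rv ∩ e := by rw [hR]; exact CDZero.Q_inter_e_eq ends a₁ a₂ a₃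
  have s2 : Q ∩ U ∩ e ∩ f = f ∩ (U ∩ e) ∩ Rv := by
    have : Q ∩ U ∩ e = (Q ∩ e) ∩ U := by
      rw [Set.inter_assoc, Set.inter_comm U e, ← Set.inter_assoc]
    rw [this, s1]
    ext ω
    simp only [Set.mem_inter_iff]
    tauto
  have s2' : Q ∩ U ∩ e = (U ∩ e) ∩ Rv := by
    have : Q ∩ U ∩ e = (Q ∩ e) ∩ U := by
      rw [Set.inter_assoc, Set.inter_comm U e, ← Set.inter_assoc]
    rw [this, s1]
    ext ω
    simp only [Set.mem_inter_iff]
    tauto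
  have s3 : Q ∩ N = Rv ∩ eᶜ := by
    rw [hR]
    ext ω
    simp only [N, Set.mem_inter_iff, Set.mem_compl_iff]
    tauto
  have s4 : Q ∩ N ∩ f = Rv ∩ eᶜ ∩ f := by rw [s3]
  -- splits of `P(R)` and `P(f ∩ R)` along `e`
  have hRsplit : prob p Rv = prob p (e ∩ Rv) + prob p (Rv ∩ eᶜ) := by
    have := prob_inter_add_prob_inter_compl p Rv e
    rw [Set.inter_comm Rv e] at this
    exact this.symm
  have hfsplit : prob p (f ∩ Rv) = prob p (f ∩ e ∩ Rv) + prob p (Rv ∩ eᶜ ∩ f) := by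
    have := prob_inter_add_prob_inter_compl p (f ∩ Rv) e
    rw [show f ∩ Rv ∩ e = f ∩ e ∩ Rv by rw [Set.inter_right_comm],
      show f ∩ Rv ∩ eᶜ = Rv ∩ eᶜ ∩ f by
        ext ω
        simp only [Set.mem_inter_iff]
        tauto] at this
    exact this.symm
  -- nonnegativity
  have hx0 : 0 ≤ prob p (f ∩ (U ∩ e) ∩ Rv) := prob_nonneg hp _
  have hy0 : 0 ≤ prob p ((U ∩ e) ∩ Rv) := prob_nonneg hp _
  have hD0 : 0 ≤ prob p (Rv ∩ eᶜ) := prob_nonneg hp _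
  have hFf0 : 0 ≤ prob p (Rv ∩ eᶜ ∩ f) := prob_nonneg hp _
  have hE0 : 0 ≤ prob p (e ∩ Rv) := prob_nonneg hp _
  have hFe0 : 0 ≤ prob p (f ∩ e ∩ Rv) := prob_nonneg hp _
  have hF0 : 0 ≤ prob p (f ∩ Rv) := prob_nonneg hp _
  have hxR : prob p (f ∩ (U ∩ e) ∩ Rv) ≤ prob p Rv := prob_mono hp Set.inter_subset_right
  rw [s2, s2', s4, s3]
  -- the chain `x·D·R ≤ y·F·D ≤ y·Ff·R`, then divide by `P(R)` (or `P(R) = 0` forces `x = 0`)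
  rcases (prob_nonneg hp Rv).lt_or_eq with hRpos | hR0
  · have key : prob p (f ∩ (U ∩ e) ∩ Rv) * prob p (Rv ∩ eᶜ) * prob p Rv ≤
        prob p ((U ∩ e) ∩ Rv) * prob p (Rv ∩ eᶜ ∩ f) * prob p Rv := by
      rw [hRsplit] at hbhk1 hbhk2
      rw [hfsplit] at hbhk1 hbhk2
      nlinarith [hbhk1, hbhk2, mul_nonneg hy0 hD0, mul_nonneg hy0 hFf0, mul_nonneg hy0 hE0,
        mul_nonneg hD0 hx0, mul_nonneg hy0 hFe0]
    exact le_of_mul_le_mul_right key hRpos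
  · have hx : prob p (f ∩ (U ∩ e) ∩ Rv) = 0 := le_antisymm (hR0 ▸ hxR) hx0
    rw [hx, zero_mul]
    exact mul_nonneg hy0 hFf0

/-- The consequence with the row's constant `γ`: `P_Q(o ∈ C₂ ∣ C₁ ∈ 𝓔, a₃ ∈ C₁) ≤ P_Q(o ∈ W ∣ a₃ ∉ W)`
in cleared form, `P(Q ∩ U ∩ e ∩ f) · P(Q ∩ N) ≤ P(Q ∩ U ∩ e) · P(Q ∩ N ∩ oU)` with
`oU = {o ∈ C₁} ∪ {o ∈ C₂}` (the up-set version of `CDZero.cd_zero`). -/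
theorem odds_upset_gamma (p : E → R) (hp : IsProbVec p) (ends : E → Sym2 V) (a₁ a₂ a₃ o : V)
    {𝓔 : Set (Set V)} (h𝓔 : IsUpperSet 𝓔) :
    let Q := (connEvent ends a₁ a₂)ᶜ
    let U := clusterInEvent ends a₁ 𝓔
    let e := connEvent ends a₁ a₃
    let f := connEvent ends a₂ o
    let N := (connEvent ends a₁ a₃)ᶜ ∩ (connEvent ends a₂ a₃)ᶜ
    let oU := connEvent ends a₁ o ∪ connEvent ends a₂ o
    prob p (Q ∩ U ∩ e ∩ f) * prob p (Q ∩ N) ≤ prob p (Q ∩ U ∩ e) * prob p (Q ∩ N ∩ oU) := by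
  intro Q U e f N oU
  have h := odds_upset p hp ends a₁ a₂ a₃ o h𝓔
  have hmono : prob p (Q ∩ N ∩ f) ≤ prob p (Q ∩ N ∩ oU) :=
    prob_mono hp (Set.inter_subset_inter_right _ Set.subset_union_right)
  have h0 : 0 ≤ prob p (Q ∩ U ∩ e) := prob_nonneg hp _
  exact h.trans (mul_le_mul_of_nonneg_left hmono h0)

end Main

end CDOddsUpset

end Summit.Ventures.PercRepro2
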